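import Summits.CriticalPhenomena.PercolationContinuityZ3.Theorems.PercLowPointHalfSpaceQuantitativeBGNWallTwoGhostKappa
import HarnessLib

/-!
# `QuantitativeBGN` (stmt-CriticalPhenomena-0913), line `longrange-wall-ghost-bootstrap` — K1, truncated second moment

Part of the stub `stub_wallTwoGhost` (K1, basic two-ghost inequality on the wall; template
`Literature/Probability/Percolation/TwoGhostInequalityProofs.lean`, Step 5 / Part A). The second-moment
input of Hutchcroft's argument (Ann. Probab. 48 (2020), §3, proof of Thm. 1.6: `E Z_n² ≤ p(1-p) n`), on the
wall of the augmented model: explore `C_H(0)` in the truncated step graph `trG L` edge by edge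
(`ClusterExploration.run (trG L) (T+2) 0`), scoring the query of `e` by `κ(e)(ω_e - w_e)` as long as at
most `N` wall vertices are active (`incr`, cutoff `wallCard ≤ N`). Namespace `…Theorems.WallTwoGhost`:

* the increments have conditional mean `0`, are bounded, and have conditional variance `≤ κ(e)² w_e`;
* **pointwise** `Σ_{j<k} Var_j ≤ N · 4V_c`: while the cutoff is not exceeded every queried edge is
  charged to an active wall vertex, and each wall vertex carries `≤ 4V_c` (`star_bound`); hence
  `E[S_T²] ≤ 4 N V_c` (`integral_proc_sq_le`);
* on `{C_H^{ω}(0) finite, |C_H(0)|(6+(2L+1)³) ≤ T, F ≤ N}` (`ω ⊆ E(trG L)`) the cutoff never bites, all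
  steps touching the cluster are queried after `T` steps (`ClusterExploration.queried_run_eq`), and
  the terminal value is the fluctuation statistic `Z^c` (`proc_eq_Zc`);
* **the truncated second-moment bound** `E[Z^c(ω_L)² ; …] ≤ 4 N V_c`, `ω_L = ω ∩ E(trG L)`, uniformly in
  `L, T` (`lintegral_trunc_Zc_sq_le`, registered as `wallTwoGhost_trunc_second_moment`).
-/

noncomputable section

namespace Summit.CriticalPhenomena.PercolationContinuityZ3.Theorems

open MeasureTheory Filter Literature.Probability.Percolation Literature.Probability.LatticeModels
open Summit.CriticalPhenomena.PercolationContinuityZ3.Theorems.WallGhost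
open scoped ENNReal

namespace WallTwoGhost
/-! ### The truncated wall-bond martingale and its second moment -/

section Moment

open ClusterExploration

/-- The number of active WALL vertices of a state. [folklore] -/
def wallCard (σ : State (Site 3)) : ℕ := (σ.A.filter fun u => u 0 = 0).card

open Classical in
/-- **The increment of the truncated wall-bond martingale with footprint cutoff `N`**: from a non-halted
state with at most `N` active wall vertices, the query of `e` scores `κ(e)(answer - w_e)`; otherwise `0`.
[cite: Hutchcroft2020Locality, §3, proof of Thm. 1.6 (the martingale Z_n)] -/
def incr (p : unitInterval) (lam α : ℝ) (c : Site 3 → ℝ) (s : Finset (Site 3)) (L T N : ℕ)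
    (σ : State (Site 3)) (b : Bool) : ℝ :=
  if h : Halted (trG L) (T + 2) σ then 0
  else if wallCard σ ≤ N then
    kap c s (nextEdge (trG L) (T + 2) σ h) *
      ((if b then 1 else 0) - (augProb p lam α (nextEdge (trG L) (T + 2) σ h) : ℝ))
  else 0

variable (p : unitInterval) (lam α : ℝ) (c : Site 3 → ℝ) (s : Finset (Site 3)) (L T N : ℕ)

/-- The increments have conditional mean zero. [cite: Hutchcroft2020Locality, §3, proof of Thm. 1.6] -/
theorem stepMean_incr (σ : State (Site 3)) : stepMean (trG L) (T + 2) (augProb p lam α) (incr p lam α c s L T N) σ = 0 := by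
  unfold stepMean incr
  by_cases h : Halted (trG L) (T + 2) σ
  · rw [dif_pos h]
  · rw [dif_neg h]
    simp only [dif_neg h, ite_true, Bool.false_eq_true, ite_false]
    split_ifs <;> ring

/-- The increments are bounded by `Σ_{x∈s} |c_x|`. [folklore] -/
theorem abs_incr_le (σ : State (Site 3)) (b : Bool) : |incr p lam α c s L T N σ b| ≤ ∑ x ∈ s, |c x| := by
  have h0 : (0 : ℝ) ≤ ∑ x ∈ s, |c x| := Finset.sum_nonneg fun x _ => abs_nonneg _
  unfold incr
  by_cases h : Halted (trG L) (T + 2) σ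
  · rw [dif_pos h, abs_zero]; exact h0
  rw [dif_neg h]
  by_cases h' : wallCard σ ≤ N
  · rw [if_pos h', abs_mul]
    have hw := (augProb p lam α (nextEdge (trG L) (T + 2) σ h)).2
    have hb : |(if b then (1 : ℝ) else 0) - (augProb p lam α (nextEdge (trG L) (T + 2) σ h) : ℝ)| ≤ 1 := by
      rw [abs_le]
      cases b
      · simp only [Bool.false_eq_true, ite_false]; constructor <;> linarith [hw.1, hw.2]
      · simp only [ite_true]; constructor <;> linarith [hw.1, hw.2]
    calc |kap c s (nextEdge (trG L) (T + 2) σ h)| * |(if b then (1 : ℝ) else 0) - (augProb p lam α (nextEdge (trG L) (T + 2) σ h) : ℝ)|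
        ≤ (∑ x ∈ s, |c x|) * 1 := mul_le_mul (abs_kap_le c s _) hb (abs_nonneg _) h0
      _ = ∑ x ∈ s, |c x| := mul_one _
  · rw [if_neg h', abs_zero]; exact h0

open Classical in
/-- The conditional variance of an increment is at most `κ(e)² w_e` (and `0` beyond the cutoff).
[cite: Hutchcroft2020Locality, §3, proof of Thm. 1.6] -/
theorem stepMean_incr_sq_le (σ : State (Site 3)) :
    stepMean (trG L) (T + 2) (augProb p lam α) (fun σ b => (incr p lam α c s L T N σ b) ^ 2) σ ≤
      if h : Halted (trG L) (T + 2) σ then 0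
      else if wallCard σ ≤ N then
        kap c s (nextEdge (trG L) (T + 2) σ h) ^ 2 * (augProb p lam α (nextEdge (trG L) (T + 2) σ h) : ℝ)
      else 0 := by
  unfold stepMean incr
  by_cases h : Halted (trG L) (T + 2) σ
  · rw [dif_pos h, dif_pos h]
  · rw [dif_neg h, dif_neg h]
    simp only [dif_neg h, ite_true, Bool.false_eq_true, ite_false]
    have hw := (augProb p lam α (nextEdge (trG L) (T + 2) σ h)).2
    set w : ℝ := (augProb p lam α (nextEdge (trG L) (T + 2) σ h) : ℝ) with hwdef
    set κ : ℝ := kap c s (nextEdge (trG L) (T + 2) σ h) with hκ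
    by_cases h' : wallCard σ ≤ N
    · simp only [if_pos h']
      have : w * (κ * (1 - w)) ^ 2 + (1 - w) * (κ * (0 - w)) ^ 2 = κ ^ 2 * w - κ ^ 2 * w * w := by ring
      rw [this]
      nlinarith [mul_nonneg (mul_nonneg (sq_nonneg κ) hw.1) hw.1]
    · simp only [if_neg h']
      norm_num

/-- The conditional variances are nonnegative. [folklore] -/
theorem stepMean_sq_nonneg (Φ : State (Site 3) → Bool → ℝ) (σ : State (Site 3)) :
    0 ≤ stepMean (trG L) (T + 2) (augProb p lam α) (fun σ b => (Φ σ b) ^ 2) σ := by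
  unfold stepMean
  split_ifs with h
  · exact le_rfl
  · have hw := (augProb p lam α (nextEdge (trG L) (T + 2) σ h)).2
    exact add_nonneg (mul_nonneg hw.1 (sq_nonneg _)) (mul_nonneg (by linarith [hw.2]) (sq_nonneg _))

open Classical in
/-- **All queried edges are charged to active wall vertices**: after `k + 1` steps,
`Σ_{e queried} κ(e)² w_e ≤ #(active wall vertices at time k) · 4V_c`.
[cite: Hutchcroft2020Locality, §3, proof of Thm. 1.6] -/
theorem sum_queried_sq_le {c : Site 3 → ℝ} {s : Finset (Site 3)} (hc : ∀ x ∈ s, 0 ≤ c x)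
    (hs : ∀ x ∈ s, x 0 = 0) (ω : Set (Sym2 (Site 3))) (k : ℕ) :
    ∑ e ∈ queried (run (trG L) (T + 2) 0 ω (k + 1)), kap c s e ^ 2 * (augProb p lam α e : ℝ) ≤
      wallCard (run (trG L) (T + 2) 0 ω k) * (4 * Vc p lam α c s) := by
  set σ := run (trG L) (T + 2) 0 ω k with hσ
  set U := σ.A.filter fun u => u 0 = 0 with hU
  set f : Sym2 (Site 3) → ℝ := fun e => kap c s e ^ 2 * (augProb p lam α e : ℝ) with hf
  have hf0 : ∀ e, 0 ≤ f e := fun e => mul_nonneg (sq_nonneg _) (augProb p lam α e).2.1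
  -- the queried edges with `κ ≠ 0` lie in the stars of the active wall vertices
  have hsub : (queried (run (trG L) (T + 2) 0 ω (k + 1))).filter (fun e => f e ≠ 0) ⊆
      U.biUnion fun u => ((trG L).neighborFinset u).image fun v => s(u, v) := by
    intro e he
    rw [Finset.mem_filter] at he
    obtain ⟨he, hne⟩ := he
    have hk : kap c s e ≠ 0 := fun h0 => hne (by simp [hf, h0])
    obtain ⟨u, hu, hue⟩ := exists_mem_A_of_mem_queried (G := trG L) (n := T + 2) 0 ω k e he
    have hE : e ∈ (trG L).edgeSet := ((inv_run (G := trG L) (n := T + 2) 0 ω (k + 1)).queried_spec e he).1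
    have hu0 : u 0 = 0 := wall_of_kap_ne_zero hs hk hue
    rw [Finset.mem_biUnion]
    refine ⟨u, Finset.mem_filter.2 ⟨hu, hu0⟩, Finset.mem_image.2 ⟨Sym2.Mem.other hue, ?_, Sym2.other_spec hue⟩⟩
    rw [SimpleGraph.mem_neighborFinset, ← SimpleGraph.mem_edgeSet, Sym2.other_spec hue]
    exact hE
  calc ∑ e ∈ queried (run (trG L) (T + 2) 0 ω (k + 1)), f e
      = ∑ e ∈ (queried (run (trG L) (T + 2) 0 ω (k + 1))).filter (fun e => f e ≠ 0), f e :=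
        (Finset.sum_filter_ne_zero _).symm
    _ ≤ ∑ e ∈ U.biUnion (fun u => ((trG L).neighborFinset u).image fun v => s(u, v)), f e :=
        Finset.sum_le_sum_of_subset_of_nonneg hsub fun e _ _ => hf0 e
    _ ≤ ∑ u ∈ U, ∑ e ∈ ((trG L).neighborFinset u).image (fun v => s(u, v)), f e := sum_biUnion_le_sum U _ hf0
    _ = ∑ u ∈ U, ∑ v ∈ (trG L).neighborFinset u, f s(u, v) := by
        refine Finset.sum_congr rfl fun u _ => Finset.sum_image fun v _ v' _ h => Sym2.congr_right.1 h
    _ ≤ ∑ _u ∈ U, 4 * Vc p lam α c s :=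
        Finset.sum_le_sum fun u hu => star_bound p lam α hc hs L (Finset.mem_filter.1 hu).2
    _ = wallCard σ * (4 * Vc p lam α c s) := by rw [Finset.sum_const, nsmul_eq_mul, wallCard]

/-- The wall count of the active set only grows. [folklore] -/
theorem wallCard_mono (ω : Set (Sym2 (Site 3))) {j k : ℕ} (h : j ≤ k) :
    wallCard (run (trG L) (T + 2) 0 ω j) ≤ wallCard (run (trG L) (T + 2) 0 ω k) := by
  induction k, h using Nat.le_induction with
  | base => exact le_rfl
  | succ k _ ih =>
    refine ih.trans (Finset.card_le_card (Finset.filter_subset_filter _ ?_))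
    rw [run_succ]; exact A_subset_step _

open Classical in
/-- **Pointwise bound on the summed conditional variances**: `Σ_{j<k} Var_j ≤ N · 4V_c` (the cutoff
stops the charging once more than `N` wall vertices are active).
[cite: Hutchcroft2020Locality, §3, proof of Thm. 1.6] -/
theorem sum_stepMean_sq_le {c : Site 3 → ℝ} {s : Finset (Site 3)} (hc : ∀ x ∈ s, 0 ≤ c x)
    (hs : ∀ x ∈ s, x 0 = 0) (ω : Set (Sym2 (Site 3))) :
    ∀ k, ∑ j ∈ Finset.range k, stepMean (trG L) (T + 2) (augProb p lam α)
        (fun σ b => (incr p lam α c s L T N σ b) ^ 2) (run (trG L) (T + 2) 0 ω j) ≤ N * (4 * Vc p lam α c s)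
  | 0 => by simpa using mul_nonneg (Nat.cast_nonneg N) (mul_nonneg (by norm_num) (Vc_nonneg p lam α c s))
  | k + 1 => by
    rw [Finset.sum_range_succ]
    by_cases hgood : ¬ Halted (trG L) (T + 2) (run (trG L) (T + 2) 0 ω k) ∧ wallCard (run (trG L) (T + 2) 0 ω k) ≤ N
    · -- the last step is charged: bound the whole sum by the queried edges
      obtain ⟨hH, hN⟩ := hgood
      set Ψ : State (Site 3) → Bool → ℝ := fun σ _ =>
        if h : Halted (trG L) (T + 2) σ then 0
        else kap c s (nextEdge (trG L) (T + 2) σ h) ^ 2 * (augProb p lam α (nextEdge (trG L) (T + 2) σ h) : ℝ) with hΨ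
      have hterm : ∀ j, stepMean (trG L) (T + 2) (augProb p lam α) (fun σ b => (incr p lam α c s L T N σ b) ^ 2)
          (run (trG L) (T + 2) 0 ω j) ≤ stepVal (trG L) (T + 2) Ψ 0 j ω := by
        intro j
        refine (stepMean_incr_sq_le p lam α c s L T N _).trans ?_
        unfold stepVal
        by_cases h : Halted (trG L) (T + 2) (run (trG L) (T + 2) 0 ω j)
        · rw [dif_pos h, dif_pos h]
        · rw [dif_neg h, dif_neg h, hΨ]
          simp only [dif_neg h]
          split_ifs
          · exact le_rfl
          · exact mul_nonneg (sq_nonneg _) (augProb p lam α _).2.1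
      have hψ : ∀ j < k + 1, ∀ (h : ¬ Halted (trG L) (T + 2) (run (trG L) (T + 2) 0 ω j)) (b : Bool),
          Ψ (run (trG L) (T + 2) 0 ω j) b =
            (fun e (_ : Bool) => kap c s e ^ 2 * (augProb p lam α e : ℝ)) (nextEdge (trG L) (T + 2) (run (trG L) (T + 2) 0 ω j) h) b := by
        intro j _ h b; simp only [hΨ, dif_neg h]
      have hnd := (inv_run (G := trG L) (n := T + 2) 0 ω (k + 1)).nodup
      calc ∑ j ∈ Finset.range k, stepMean (trG L) (T + 2) (augProb p lam α) (fun σ b => (incr p lam α c s L T N σ b) ^ 2)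
              (run (trG L) (T + 2) 0 ω j) +
            stepMean (trG L) (T + 2) (augProb p lam α) (fun σ b => (incr p lam α c s L T N σ b) ^ 2) (run (trG L) (T + 2) 0 ω k)
          = ∑ j ∈ Finset.range (k + 1), stepMean (trG L) (T + 2) (augProb p lam α)
              (fun σ b => (incr p lam α c s L T N σ b) ^ 2) (run (trG L) (T + 2) 0 ω j) := (Finset.sum_range_succ _ _).symm
        _ ≤ ∑ j ∈ Finset.range (k + 1), stepVal (trG L) (T + 2) Ψ 0 j ω := Finset.sum_le_sum fun j _ => hterm j
        _ = proc (trG L) (T + 2) Ψ 0 (k + 1) ω := (proc_eq_sum_stepVal Ψ 0 ω (k + 1)).symm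
        _ = ((run (trG L) (T + 2) 0 ω (k + 1)).hist.map fun eb => kap c s eb.1 ^ 2 * (augProb p lam α eb.1 : ℝ)).sum :=
            proc_eq_sum_hist (G := trG L) (n := T + 2) (Φ := Ψ) (fun e _ => kap c s e ^ 2 * (augProb p lam α e : ℝ)) 0 ω (k + 1) hψ
        _ = ∑ e ∈ queried (run (trG L) (T + 2) 0 ω (k + 1)), kap c s e ^ 2 * (augProb p lam α e : ℝ) := by
            rw [queried, List.sum_toFinset _ hnd, List.map_map]; rfl
        _ ≤ wallCard (run (trG L) (T + 2) 0 ω k) * (4 * Vc p lam α c s) := sum_queried_sq_le p lam α L T hc hs ω k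
        _ ≤ N * (4 * Vc p lam α c s) :=
            mul_le_mul_of_nonneg_right (by exact_mod_cast hN) (mul_nonneg (by norm_num) (Vc_nonneg p lam α c s))
    · -- the last step is not charged
      have h0 : stepMean (trG L) (T + 2) (augProb p lam α) (fun σ b => (incr p lam α c s L T N σ b) ^ 2)
          (run (trG L) (T + 2) 0 ω k) = 0 := by
        refine le_antisymm ((stepMean_incr_sq_le p lam α c s L T N _).trans ?_) (stepMean_sq_nonneg p lam α L T _ _)
        split_ifs with h1 h2
        · exact le_rfl
        · exact absurd ⟨h1, h2⟩ hgood
        · exact le_rfl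
      rw [h0, add_zero]
      exact sum_stepMean_sq_le hc hs ω k

/-- **Second moment of the truncated martingale**: `E[S_T²] ≤ N · 4V_c`.
[cite: Hutchcroft2020Locality, §3, proof of Thm. 1.6] -/
theorem integral_proc_sq_le {c : Site 3 → ℝ} {s : Finset (Site 3)} (hc : ∀ x ∈ s, 0 ≤ c x)
    (hs : ∀ x ∈ s, x 0 = 0) (k : ℕ) :
    ∫ ω, (proc (trG L) (T + 2) (incr p lam α c s L T N) 0 k ω) ^ 2 ∂(augWall p lam α) ≤ N * (4 * Vc p lam α c s) := by
  rw [augWall, integral_proc_sq_eq (augProb p lam α) (abs_incr_le p lam α c s L T N) (stepMean_incr p lam α c s L T N) 0 k,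
    ← integral_finsetSum _ fun j _ => integrable_comp_run' _ 0 j _]
  calc ∫ ω, ∑ j ∈ Finset.range k, stepMean (trG L) (T + 2) (augProb p lam α)
          (fun σ b => (incr p lam α c s L T N σ b) ^ 2) (run (trG L) (T + 2) 0 ω j) ∂(prodBernoulli (augProb p lam α))
      ≤ ∫ _, (N * (4 * Vc p lam α c s) : ℝ) ∂(prodBernoulli (augProb p lam α)) :=
        integral_mono (integrable_finsetSum _ fun j _ => integrable_comp_run' _ 0 j _) (integrable_const _)
          fun ω => sum_stepMean_sq_le p lam α L T N hc hs ω k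
    _ = N * (4 * Vc p lam α c s) := by simp

end Moment


/-! ### Identification of the terminal value with `Z^c` on small clusters -/

section Ident

open ClusterExploration

variable (p : unitInterval) (lam α : ℝ) (c : Site 3 → ℝ) {s : Finset (Site 3)} {L : ℕ} (T N : ℕ)

/-- The label finsets of a finite `H`-cluster enumerate exactly the wall labels of the bonds of type
`x ∈ s` among the steps of `trG L` touching the cluster (`‖x‖ ≤ L`). [folklore] -/
theorem mem_labFin_iff (hs : ∀ x ∈ s, x 0 = 0 ∧ x ≠ 0 ∧ ‖x‖ ≤ L) {ω : Set (Sym2 (Site 3))}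
    (hfin : (clusterH ω 0).Finite) {x : Site 3} (hx : x ∈ s) (u : Site 3) :
    u ∈ (labTouch_finite hfin x).toFinset ↔ u 0 = 0 ∧ s(u, u + x) ∈ edgesTouching (trG L) hfin.toFinset := by
  obtain ⟨hx0, hxne, hxL⟩ := hs x hx
  rw [Set.Finite.mem_toFinset, mem_labTouch, mem_edgesTouching_iff]
  constructor
  · rintro ⟨hu, hC⟩
    refine ⟨hu, mk_add_mem_edgeSet_trG hu hx0 hxne hxL, ?_⟩
    rcases hC with hC | hC
    · exact ⟨u, hfin.mem_toFinset.2 hC, Sym2.mem_mk_left _ _⟩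
    · exact ⟨u + x, hfin.mem_toFinset.2 hC, Sym2.mem_mk_right _ _⟩
  · rintro ⟨hu, -, y, hy, hye⟩
    refine ⟨hu, ?_⟩
    rw [hfin.mem_toFinset] at hy
    rcases Sym2.mem_iff.1 hye with rfl | rfl
    · exact Or.inl hy
    · exact Or.inr hy

open Classical in
/-- Per type: the label sum of `(state - q)` is `#open - q_x #all`. [folklore] -/
theorem sum_labFin_eq {ω : Set (Sym2 (Site 3))} (hfin : (clusterH ω 0).Finite) (x : Site 3) :
    ∑ u ∈ (labTouch_finite hfin x).toFinset, ((if s(u, u + x) ∈ ω then (1 : ℝ) else 0) - (augProb p lam α s(u, u + x) : ℝ)) =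
      (nSt true ω x : ℝ) - wallBondProb p lam α x * nAll ω x := by
  have hU : (↑(labTouch_finite hfin x).toFinset : Set (Site 3)) = labTouch ω x := (labTouch_finite hfin x).coe_toFinset
  rw [Finset.sum_sub_distrib, Finset.sum_boole, nSt_eq_card hU true, nAll_eq_card hU]
  have hfilt : ((labTouch_finite hfin x).toFinset.filter fun u => s(u, u + x) ∈ ω) =
      (labTouch_finite hfin x).toFinset.filter fun u => (s(u, u + x) ∈ ω ↔ true = true) :=
    Finset.filter_congr fun u _ => by simp
  congr 1
  · rw [hfilt]
  · rw [Finset.sum_congr rfl (g := fun _ => wallBondProb p lam α x) fun u hu => by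
      rw [Set.Finite.mem_toFinset, mem_labTouch] at hu
      rw [wallBondProb, augProb_mk_add p lam α hu.1 x], Finset.sum_const, nsmul_eq_mul, mul_comm]

open Classical in
/-- **On a configuration of `E(trG L)` whose `H`-cluster of `0` is finite, touches at most `T` steps and
has footprint `≤ N`, the terminal value of the truncated martingale is `Z^c`.**
[cite: Hutchcroft2020Locality, §3, proof of Thm. 1.6 (Z_T = -h_p(K))] -/
theorem proc_eq_Zc (hs : ∀ x ∈ s, x 0 = 0 ∧ x ≠ 0 ∧ ‖x‖ ≤ L) {ω : Set (Sym2 (Site 3))}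
    (hω : ω ⊆ (trG L).edgeSet) (hfin : (clusterH ω 0).Finite)
    (hT : (clusterH ω 0).ncard * (6 + (2 * L + 1) ^ 3) ≤ T) (hN : footN ω 0 ≤ N) :
    proc (trG L) (T + 2) (incr p lam α c s L T N) 0 T ω = Zc p lam α c s ω := by
  set K := hfin.toFinset with hKdef
  have hωE : ω ∩ (trG L).edgeSet = ω := Set.inter_eq_left.2 hω
  have hC : clusterH ω 0 = openCluster ω 0 := by
    have := clusterH_trunc_eq (x := (0 : Site 3)) le_rfl ω L
    rwa [hωE] at this
  have hK : (↑K : Set (Site 3)) = openCluster ω 0 := by rw [hKdef, hfin.coe_toFinset, hC]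
  have hcardT : (edgesTouching (trG L) K).card ≤ T :=
    (card_edgesTouching_trG_le L K).trans (by rwa [hKdef, ← Set.ncard_eq_toFinset_card _ hfin])
  -- along the run at most `N` wall vertices are active, so every increment is charged
  have hwc : ∀ j, wallCard (run (trG L) (T + 2) 0 ω j) ≤ N := by
    intro j
    refine le_trans ?_ hN
    rw [wallCard, footN, ← Set.ncard_coe_finset]
    refine Set.ncard_le_ncard (fun u hu => ?_) (hfin.subset Set.inter_subset_left)
    rw [Finset.coe_filter] at hu
    refine ⟨?_, hu.2⟩
    rw [hC]
    exact coe_A_subset_openCluster (G := trG L) (n := T + 2) 0 ω j (Finset.mem_coe.2 hu.1)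
  set ψ : Sym2 (Site 3) → Bool → ℝ := fun e b => kap c s e * ((if b then 1 else 0) - (augProb p lam α e : ℝ)) with hψdef
  have hψ : ∀ j < T, ∀ (h : ¬ Halted (trG L) (T + 2) (run (trG L) (T + 2) 0 ω j)) (b : Bool),
      incr p lam α c s L T N (run (trG L) (T + 2) 0 ω j) b = ψ (nextEdge (trG L) (T + 2) (run (trG L) (T + 2) 0 ω j) h) b := by
    intro j _ h b
    unfold incr
    rw [dif_neg h, if_pos (hwc j)]
  have hI := inv_run (G := trG L) (n := T + 2) 0 ω T
  set g : Sym2 (Site 3) → ℝ := fun e => (if e ∈ ω then 1 else 0) - (augProb p lam α e : ℝ) with hgdef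
  -- the recorded answers are the states in `ω`
  have h2 : ((run (trG L) (T + 2) 0 ω T).hist.map fun eb => ψ eb.1 eb.2) =
      ((run (trG L) (T + 2) 0 ω T).hist.map Prod.fst).map fun e => kap c s e * g e := by
    rw [List.map_map]
    refine List.map_congr_left fun eb heb => ?_
    have ha := hI.answers eb heb
    simp only [Function.comp_apply, hψdef, hgdef]
    congr 2
    by_cases hb : eb.2 = true
    · rw [if_pos hb, if_pos (ha.2 hb)]
    · rw [if_neg hb, if_neg (fun h => hb (ha.1 h))]
  rw [proc_eq_sum_hist (G := trG L) (n := T + 2) (Φ := incr p lam α c s L T N) ψ 0 ω T hψ, h2,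
    ← List.sum_toFinset _ hI.nodup]
  change ∑ e ∈ queried (run (trG L) (T + 2) 0 ω T), kap c s e * g e = Zc p lam α c s ω
  rw [queried_run_eq 0 hω hK hcardT le_rfl,
    sum_kap_mul_eq c s _ g (fun x => (labTouch_finite hfin x).toFinset) (fun x hx u => mem_labFin_iff hs hfin hx u), Zc]
  refine Finset.sum_congr rfl fun x hx => ?_
  rw [sum_labFin_eq p lam α hfin x]

/-- **The truncated second-moment bound.** For weights `c ≥ 0` on finitely many wall types `s` of range
`≤ L`: `E[ Z^c(ω_L)² ; C_H^{ω_L}(0) finite, |C_H^{ω_L}(0)| (6+(2L+1)³) ≤ T, F(ω_L) ≤ N ] ≤ 4 N V_c`,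
`ω_L = ω ∩ E(trG L)`, uniformly in `L` and `T`. [cite: Hutchcroft2020Locality, §3, proof of Thm. 1.6] -/
theorem lintegral_trunc_Zc_sq_le (hs : ∀ x ∈ s, x 0 = 0 ∧ x ≠ 0 ∧ ‖x‖ ≤ L) (hc : ∀ x ∈ s, 0 ≤ c x) :
    ∫⁻ ω, {ω : BondConfig (Site 3) | (clusterH (ω ∩ (trG L).edgeSet) 0).Finite ∧
        (clusterH (ω ∩ (trG L).edgeSet) 0).ncard * (6 + (2 * L + 1) ^ 3) ≤ T ∧ footN (ω ∩ (trG L).edgeSet) 0 ≤ N}.indicator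
        (fun ω => ENNReal.ofReal (Zc p lam α c s (ω ∩ (trG L).edgeSet) ^ 2)) ω ∂(augWall p lam α) ≤
      ENNReal.ofReal (N * (4 * Vc p lam α c s)) := by
  set μ := augWall p lam α with hμ
  set S : BondConfig (Site 3) → ℝ := fun ω => proc (trG L) (T + 2) (incr p lam α c s L T N) 0 T ω with hS
  have hpt : ∀ ω, {ω : BondConfig (Site 3) | (clusterH (ω ∩ (trG L).edgeSet) 0).Finite ∧
      (clusterH (ω ∩ (trG L).edgeSet) 0).ncard * (6 + (2 * L + 1) ^ 3) ≤ T ∧ footN (ω ∩ (trG L).edgeSet) 0 ≤ N}.indicator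
      (fun ω => ENNReal.ofReal (Zc p lam α c s (ω ∩ (trG L).edgeSet) ^ 2)) ω ≤ ENNReal.ofReal ((S ω) ^ 2) := by
    intro ω
    by_cases hmem : ω ∈ {ω : BondConfig (Site 3) | (clusterH (ω ∩ (trG L).edgeSet) 0).Finite ∧
      (clusterH (ω ∩ (trG L).edgeSet) 0).ncard * (6 + (2 * L + 1) ^ 3) ≤ T ∧ footN (ω ∩ (trG L).edgeSet) 0 ≤ N}
    · rw [Set.indicator_of_mem hmem]
      obtain ⟨hfin, hT, hN⟩ := hmem
      have h1 := proc_eq_Zc p lam α c T N hs (Set.inter_subset_right) hfin hT hN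
      have h2 : S ω = Zc p lam α c s (ω ∩ (trG L).edgeSet) := by
        rw [← h1, hS]
        exact (proc_congr _ 0 T (run_inter_edgeSet (G := trG L) (n := T + 2) 0 ω T)).symm
      rw [h2]
    · rw [Set.indicator_of_notMem hmem]; exact bot_le
  have hSm : Measurable S := measurable_proc _ 0 T
  have hSb := abs_proc_le (G := trG L) (n := T + 2) (abs_incr_le p lam α c s L T N) 0 T
  have hint : Integrable (fun ω => (S ω) ^ 2) μ := by
    refine integrable_of_abs_le μ (hSm.pow_const 2) (B := (T * ∑ x ∈ s, |c x|) ^ 2) fun ω => ?_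
    rw [abs_pow]; exact pow_le_pow_left₀ (abs_nonneg _) (hSb ω) 2
  calc ∫⁻ ω, _ ∂μ ≤ ∫⁻ ω, ENNReal.ofReal ((S ω) ^ 2) ∂μ := lintegral_mono hpt
    _ = ENNReal.ofReal (∫ ω, (S ω) ^ 2 ∂μ) :=
        (ofReal_integral_eq_lintegral_ofReal hint (Filter.Eventually.of_forall fun ω => sq_nonneg _)).symm
    _ ≤ ENNReal.ofReal (N * (4 * Vc p lam α c s)) :=
        ENNReal.ofReal_le_ofReal (integral_proc_sq_le p lam α L T N hc (fun x hx => (hs x hx).1) T)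

end Ident



end WallTwoGhost

open WallTwoGhost in
/-- **K1, part 5 (truncated second moment).** For weights `c ≥ 0` on finitely many long wall-bond types
`s` of range `≤ L`, the fluctuation statistic `Z^c` of the truncated configuration `ω_L = ω ∩ E(trG L)`
satisfies `E[Z^c(ω_L)² ; C_H^{ω_L}(0) finite and small, F(ω_L) ≤ N] ≤ 4 N V_c`, uniformly in `L` and in
the size cutoff `T` (exploration martingale on `trG L` with increments on wall bonds only, footprint
cutoff `N`, no maximal inequality). [cite: Hutchcroft2020Locality, §3, proof of Thm. 1.6] -/
theorem wallTwoGhost_trunc_second_moment : ∀ (p : unitInterval) (lam α : ℝ) (c : Site 3 → ℝ) (s : Finset (Site 3)) (L T N : ℕ), (∀ x ∈ s, x 0 = 0 ∧ x ≠ 0 ∧ ‖x‖ ≤ L) → (∀ x ∈ s, 0 ≤ c x) → ∫⁻ ω, {ω : BondConfig (Site 3) | (clusterH (ω ∩ (trG L).edgeSet) 0).Finite ∧ (clusterH (ω ∩ (trG L).edgeSet) 0).ncard * (6 + (2 * L + 1) ^ 3) ≤ T ∧ footN (ω ∩ (trG L).edgeSet) 0 ≤ N}.indicator (fun ω => ENNReal.ofReal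 (Zc p lam α c s (ω ∩ (trG L).edgeSet) ^ 2)) ω ∂(augWall p lam α) ≤ ENNReal.ofReal (N * (4 * Vc p lam α c s)) :=
  fun p lam α c _ _ T N hs hc => lintegral_trunc_Zc_sq_le p lam α c T N hs hc

end Summit.CriticalPhenomena.PercolationContinuityZ3.Theorems
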